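import Literature.NumberTheory.ConnesConsani2021.ArchKernelTier2Assembly
import HarnessLib

/-!
# (E-a) Tier 2 — bridge from the `Option` form of the S₈ models to the stub family `s8Stub`

RH-FREE certified-numerics bookkeeping (cell rh-crit, seat rh-crit-cc-iso g4).  The consortium's (T2b-sound) theorem
(`ArchKernelTier2S8Sound.tmem_s8TM`, eng-1 g2 / t4 g4) is stated for `s8TM hQ 6 Cc combinedLit = some P`; the assembly
(`ArchKernelTier2Assembly.section6_enclosures_of_tier2_inputs`) consumes the TOTAL family
`s8Stub K = (s8TM hQ 6 (centre K) combinedLit).getD []`.  Here: (i) the kernel fact that all 64 models EXIST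
(`s8TM … (centre K) … = some _`: only the four `texpAt` enclosures are evaluated — the payload is not), (ii) the bridge
`h8_of_some`, (iii) the resulting entry point `section6_enclosures_of_some (H8) (he)`.
WHAT THIS IS NOT: a discharge of (E-a) (the S₈ identification `H8` and the slope window `he` are the consortium's), nor any
claim about RH; nothing here bears on the truth of RH.
-/

noncomputable section

open Real Set MeasureTheory
open Literature.Analysis.ValidatedNumerics.NumericsMP Literature.Analysis.ValidatedNumerics.PolyMP
open Literature.NumberTheory.ConnesConsani2021.ArchCert (S)
open Literature.NumberTheory.ConnesConsani2021.ArchCertSigma (sigmaTM hQ)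

namespace Literature.NumberTheory.ConnesConsani2021.ArchCertT2

open Literature.NumberTheory.LFunctions

set_option maxRecDepth 200000 in
/-- **All 64 stub S₈ models exist** (`isSome`; kernel: the four exponential enclosures per centre succeed).
[cite: ConnesConsani2021, §6.3 p. 24 (in-kernel (E-a) certificate)] -/
theorem s8TM_isSome : ∀ K < 64, (s8TM hQ 6 (centre K) combinedLit).isSome = true := by
  decide +kernel

/-- **Bridge**: a (T2b-sound) statement in `Option` form yields `h8` for the stub family. [cite: ConnesConsani2021, §6.3 p. 24 (in-kernel (E-a) certificate)] -/
theorem h8_of_some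
    (H8 : ∀ K < 64, ∀ P, s8TM hQ 6 (centre K) combinedLit = some P →
      TMem S hQ (fun u ↦ S8 (Real.exp (cK K + u))) P) :
    ∀ K < 64, TMem S hQ (fun u ↦ S8 (Real.exp (cK K + u))) (s8Stub K) := by
  intro K hK
  obtain ⟨P, hP⟩ := Option.isSome_iff_exists.mp (s8TM_isSome K hK)
  have hs : s8Stub K = P := by
    unfold s8Stub
    rw [hP, Option.getD_some]
  rw [hs]
  exact H8 K hK P hP

/-- **`CC2021_section6_enclosures` from the (T2b-sound) statement in `Option` form and the slope window.**
[cite: ConnesConsani2021, §6.4 Fact 6.1 + Lemma 6.3 p. 24; §6.7 Lemma 6.10 / Thm. 6.11 p. 28] -/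
theorem section6_enclosures_of_some
    (H8 : ∀ K < 64, ∀ P, s8TM hQ 6 (centre K) combinedLit = some P →
      TMem S hQ (fun u ↦ S8 (Real.exp (cK K + u))) P)
    (he : (eloQ : ℝ) ≤ ∑' n : ℕ, epsSlopeTerm (prolateFun n) ∧ ∑' n : ℕ, epsSlopeTerm (prolateFun n) ≤ (ehiQ : ℝ)) :
    CC2021_section6_enclosures :=
  section6_enclosures_of_tier2_inputs (h8_of_some H8) he

/-- **Cast bridge for the slope window**: the fine window `[eLoNum/S, eHiNum/S]` (real division by `S = 2¹²⁸`,
the shape of the consortium's `ArchCert.tsum_epsSlopeTerm_prolateFun_mem_fine`) is the assembly's window `[eloQ, ehiQ]`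
(`eloQ = eLoNum/2¹²⁸`, `ehiQ = eHiNum/2¹²⁸` as rationals). [cite: ConnesConsani2021, §5 Lemma 5.4 pp. 32–33; §6.4 p. 24] -/
theorem he_of_fine {T : ℝ}
    (hfine : (ArchCert.eLoNum : ℝ) / (S : ℝ) ≤ T ∧ T ≤ (ArchCert.eHiNum : ℝ) / (S : ℝ)) :
    (eloQ : ℝ) ≤ T ∧ T ≤ (ehiQ : ℝ) := by
  have hS : ((S : ℕ) : ℝ) = 2 ^ 128 := by norm_num [ArchCert.S]
  have hlo : ((eloQ : ℚ) : ℝ) = (ArchCert.eLoNum : ℝ) / (S : ℝ) := by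
    rw [hS, eloQ]; push_cast; rfl
  have hhi : ((ehiQ : ℚ) : ℝ) = (ArchCert.eHiNum : ℝ) / (S : ℝ) := by
    rw [hS, ehiQ]; push_cast; rfl
  rw [hlo, hhi]
  exact hfine

/-- **`CC2021_section6_enclosures` from the (T2b-sound) statement in `Option` form and the FINE slope window**
(the consortium's two deliverables, verbatim shapes: t4 g4's `H8`, gm-t16's `tsum_epsSlopeTerm_prolateFun_mem_fine`).
[cite: ConnesConsani2021, §6.4 Fact 6.1 + Lemma 6.3 p. 24; §6.7 Lemma 6.10 / Thm. 6.11 p. 28] -/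
theorem section6_enclosures_of_some_fine
    (H8 : ∀ K < 64, ∀ P, s8TM hQ 6 (centre K) combinedLit = some P →
      TMem S hQ (fun u ↦ S8 (Real.exp (cK K + u))) P)
    (hfine : (ArchCert.eLoNum : ℝ) / (S : ℝ) ≤ ∑' n : ℕ, epsSlopeTerm (prolateFun n) ∧
      ∑' n : ℕ, epsSlopeTerm (prolateFun n) ≤ (ArchCert.eHiNum : ℝ) / (S : ℝ)) :
    CC2021_section6_enclosures :=
  section6_enclosures_of_some H8 (he_of_fine hfine)

/-- Same, for the TOTAL stub family (`h8` form, as consumed by `section6_enclosures_of_tier2_inputs`) and the fine window.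
[cite: ConnesConsani2021, §6.4 Fact 6.1 + Lemma 6.3 p. 24; §6.7 Lemma 6.10 / Thm. 6.11 p. 28] -/
theorem section6_enclosures_of_stub_fine
    (h8 : ∀ K < 64, TMem S hQ (fun u ↦ S8 (Real.exp (cK K + u))) (s8Stub K))
    (hfine : (ArchCert.eLoNum : ℝ) / (S : ℝ) ≤ ∑' n : ℕ, epsSlopeTerm (prolateFun n) ∧
      ∑' n : ℕ, epsSlopeTerm (prolateFun n) ≤ (ArchCert.eHiNum : ℝ) / (S : ℝ)) :
    CC2021_section6_enclosures :=
  section6_enclosures_of_tier2_inputs h8 (he_of_fine hfine)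

end Literature.NumberTheory.ConnesConsani2021.ArchCertT2

end
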